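import Mathlib.RingTheory.Valuation.RamificationGroup
import Mathlib.RingTheory.Localization.AsSubring
import Mathlib.RingTheory.Localization.AtPrime.Basic
import Mathlib.FieldTheory.IntermediateField.Basic
import Mathlib.Algebra.Polynomial.AlgebraMap
import Literature.AlgebraicGeometry.Resolution.LocalUniformization
import Literature.AlgebraicGeometry.Resolution.ValuationDefect
import HarnessLib

/-!
# Cossart–Piltant 2008 — local models of a valuation ring and ramification vocabulary

Statement-level vocabulary of V. Cossart, O. Piltant, *Resolution of singularities of threefolds
in positive characteristic I*, J. Algebra 320 (2008) 1051–1082 (bib key `CossartPiltant2008`;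
page numbers "HAL p. N" refer to the authors' manuscript hal-00139124, whose §§6–9 are numbered
differently from the journal: HAL Prop 6.2 / Cor 6.3 / Thm 7.2 / Prop 8.1 / Prop 8.3 / Prop 9.3 /
Prop 9.5 = journal Thm 7.2 / Cor 7.3 / Thm 8.1 / Prop 6.2 / Prop 6.3 / Prop 9.1 / Prop 9.3), §3
"Local rings and models" and Definition 7.1, in the ABSTRACT-TOWER idiom (`Algebra k K`,
`Algebra K L`, `W : ValuationSubring L`) used by `Resolution.LocalUniformization`,
`Resolution.TranscendenceDefect` and `Resolution.ValuationDefect`: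

* `IsLocalModelOf k K O R`, `IsLocalUniformizationOf`, `IsNormalLocalModelOf` — a (regular,
  normal) local model `R ⊆ K` of the `k`-valuation ring `O` (HAL p. 4), realised INSIDE `K` as the
  ring of fractions `a/s`, `a, s ∈ A`, `O(s) = 0`, of an affine model `A ⊆ O`;
* `normalModelAbove W R` (`R̃`, HAL p. 17), `LiesBelow` (HAL p. 4), `IsIntegralOverSub`;
* `QIndepValues W y` — "`W y₁, …, W y_r` are linearly independent in `W_L ⊗_ℤ ℚ`" (HAL p. 22);
* `IsImmediate K W` — Definition 7.1 (HAL p. 19), via the tree's `ramificationIndex` /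
  `inertiaDegree` (`e = f = 1`);
* `InInertiaGroup`, `InRamificationGroup`, `LeInertiaField`, `LeRamificationField` — membership
  in `G_i(W/V) ⊆ G_s(W/V)` and `G_r(W/V)` (HAL pp. 5–6, after Zariski–Samuel VI §12) for a finite
  Galois `L/K`, on top of Mathlib's `ValuationSubring.decompositionSubgroup` /
  `ValuationSubring.inertiaSubgroup`; the ambient-`Ω` versions are
  `Resolution.decompositionGroupIn` / `inertiaGroupIn` / `ramificationGroupIn`
  (`KrullRamificationGroups.lean`), not restated here;
* PROVED bridge to the tree's predicate: `isLocallyUniformizable_iff_exists_isLocalUniformizationOf`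
  — `Resolution.IsLocallyUniformizable k K O` (regularity of Mathlib's `Localization.AtPrime` of an
  affine model at the centre) iff some `R ⊆ K` is a local uniformization of `O` in the sense above.

Deliberately NOT here: the numbered statements of the paper (`Ramification2008.lean`,
`Threefolds2008.lean` in this directory), anything scheme-theoretic, rank / rational rank (the
tree's `Valuation.RankOne`, `Resolution.ratRank`, `Resolution.residueTrdeg` are used downstream).
-/

noncomputable section

open Polynomial

namespace Literature.AlgebraicGeometry.CossartPiltant200819.CP2008

open Literature.AlgebraicGeometry.Resolution

universe u

section Models

variable (k K : Type u) [Field k] [Field K] [Algebra k K] (O : ValuationSubring K)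

/-- `R ⊆ K` is (the underlying `k`-subalgebra of) a **local model of the `k`-valuation ring `O`**
(Cossart–Piltant 2008, §3, HAL p. 4: "a subring `R` of `K` is … a local model of `K/k` if
`QF(R) = K` and `R` is … the localization at a prime ideal of a `k`-algebra of finite type"; "a
local model of `V/k` is a local model `R` of `K/k` such that `R < V`", i.e. `V` dominates `R`):
there is a finitely generated `k`-subalgebra `A ⊆ O` with fraction field `K` such that
`R = A_𝔭 ⊆ K` for the centre `𝔭 = 𝔪_O ∩ A` (domination forces this prime), i.e. `R` is the set of
fractions `a/s` with `a, s ∈ A` and `O(s) = 0` (multiplicatively: `O.valuation s = 1`).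
[cite: CossartPiltant2008, Section 3 (HAL p. 4, "Local rings and models")] -/
def IsLocalModelOf (R : Subalgebra k K) : Prop :=
  ∃ A : Subalgebra k K, A.FG ∧ IsFractionRing A K ∧ A.toSubring ≤ O.toSubring ∧
    (R : Set K) = {x | ∃ a ∈ A, ∃ s ∈ A, O.valuation s = 1 ∧ x = a * s⁻¹}

/-- `R ⊆ K` is a **local uniformization of the `k`-valuation ring `O`** (Cossart–Piltant 2008,
§3, HAL p. 4: "A regular local model of `V/k` is also called a local uniformization of `V/k`"):
a local model of `O` which is a regular local ring. See
`isLocallyUniformizable_iff_exists_isLocalUniformizationOf` for the comparison with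
`Resolution.IsLocallyUniformizable`. [cite: CossartPiltant2008, Section 3 (HAL p. 4)] -/
def IsLocalUniformizationOf (R : Subalgebra k K) : Prop :=
  IsLocalModelOf k K O R ∧ IsRegularLocalRing R

variable {k K}

/-- `x ∈ L` (`K ⊆ L`) is **integral over the subring `R ⊆ K`**: a root of a monic polynomial with
coefficients in `R`. [folklore] -/
def IsIntegralOverSub {L : Type u} [Field L] [Algebra K L] (R : Subalgebra k K) (x : L) : Prop :=
  ∃ q : K[X], q.Monic ∧ (∀ i, q.coeff i ∈ R) ∧ Polynomial.aeval x q = 0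

variable (k K)

/-- `R ⊆ K` is a **normal local model** of `O` (Cossart–Piltant 2008, §3, HAL p. 4: "A model is
called normal (resp. regular) if it is normal (resp. regular) as a ring"): a local model of `O`
which is integrally closed in its fraction field `K`.
[cite: CossartPiltant2008, Section 3 (HAL p. 4)] -/
def IsNormalLocalModelOf (R : Subalgebra k K) : Prop :=
  IsLocalModelOf k K O R ∧ ∀ x : K, IsIntegralOverSub (L := K) R x → x ∈ R

variable {k K}

/-- The underlying set of **`R̃`, "the unique normal local model of `W/k` which lies above `R`"**
(Cossart–Piltant 2008, Prop 6.2, HAL p. 17; §3, HAL p. 4, "lies over"), for `R ⊆ K` normal local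
and `W` a valuation ring of `L ⊇ K`: the integral closure of `R` in `L` localised at its maximal
ideal under `W`, i.e. the fractions `b/t` with `b, t ∈ L` integral over `R` and `W(t) = 0`.
[cite: CossartPiltant2008, Section 3 (HAL p. 4) and Prop 6.2 (HAL p. 17)] -/
def normalModelAbove {L : Type u} [Field L] [Algebra K L] (W : ValuationSubring L)
    (R : Subalgebra k K) : Set L :=
  {x | ∃ b t : L, IsIntegralOverSub R b ∧ IsIntegralOverSub R t ∧ W.valuation t = 1 ∧
    x = b * t⁻¹}

/-- "`R` **lies below** `S`" / "`S` lies over `R`" for `R ⊆ K` normal local and `S ⊆ K'`,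
`K ⊆ K' ⊆ L` (Cossart–Piltant 2008, §3, HAL p. 4: "`S` is the localization at a maximal ideal of
the integral closure of `R` in `K'`"), for the maximal ideal under the valuation ring `W ∩ K'`
(the case used in Prop 9.3, where `S` is dominated by `W`): the image of `S` in `L` is the set of
fractions `b/t`, `b, t ∈ K'` integral over `R`, `W(t) = 0`.
[cite: CossartPiltant2008, Section 3 (HAL p. 4, "lies over / lies below")] -/
def LiesBelow {L : Type u} [Field L] [Algebra K L] [Algebra k L] [IsScalarTower k K L]
    (W : ValuationSubring L) (R : Subalgebra k K) (K' : IntermediateField K L)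
    (S : Subalgebra k K') : Prop :=
  (S : Set K').image (algebraMap K' L) =
    {x | ∃ b t : L, b ∈ K' ∧ t ∈ K' ∧ IsIntegralOverSub R b ∧ IsIntegralOverSub R t ∧
      W.valuation t = 1 ∧ x = b * t⁻¹}

/-- The values `W y₁, …, W y_r` are **linearly independent in `W_L ⊗_ℤ ℚ`** (Cossart–Piltant
2008, Prop 8.1 (2) and Lemma 8.2, HAL p. 22), i.e. `ℤ`-independent in the value group:
`W(∏ yᵢ ^ nᵢ) = 0 ⇒ n = 0` (multiplicatively: valuation `1`), all `yᵢ ≠ 0`.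
[cite: CossartPiltant2008, Prop 8.1 (HAL p. 22)] -/
def QIndepValues {L : Type u} [Field L] (W : ValuationSubring L) {r : ℕ} (y : Fin r → L) :
    Prop :=
  (∀ i, y i ≠ 0) ∧ ∀ n : Fin r → ℤ, W.valuation (∏ i, y i ^ n i) = 1 → n = 0

/-- **Cossart–Piltant 2008, Definition 7.1** (HAL p. 19): "Let `V ⊆ W` be valuation rings (not
necessarily `k`-valuation rings). We say that `W/V` is immediate if the group and residual
extensions are trivial, i.e. the inclusions `VK ⊆ WL` and `κ(V) ⊆ κ(W)` are isomorphisms."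
Here `V = W ∩ K`; rendered with the tree's invariants as `e(W/K) = 1` and `f(W/K) = 1`
(`Resolution.ramificationIndex`, the index of the value group of `K` in that of `L`, and
`Resolution.inertiaDegree`, the degree of `κ(W)` over `κ(V)`; both are `1` exactly when the
inclusion is an equality). [cite: CossartPiltant2008, Def 7.1 (HAL p. 19)] -/
def IsImmediate (K : Type u) {L : Type u} [Field K] [Field L] [Algebra K L]
    (W : ValuationSubring L) : Prop :=
  ramificationIndex K W = 1 ∧ inertiaDegree K W = 1

end Models

section Galois

variable (K : Type u) {L : Type u} [Field K] [Field L] [Algebra K L] (W : ValuationSubring L)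

/-- `σ ∈ G_i(W/V)`, the **inertia group** (Cossart–Piltant 2008, HAL p. 5 eq. (3): "`G_i(W/V) :=
{g ∈ G_s(W/V) | ∀ x ∈ W, g.x ≡ x mod m_W}`", with `G_s(W/V) := {g ∈ G | g.W = W}`, eq. (2)):
`σ` lies in Mathlib's decomposition subgroup `W.decompositionSubgroup K` (the stabiliser of `W`)
and there in `W.inertiaSubgroup K` (the kernel of the action on the residue field `κ(W)`).
[cite: CossartPiltant2008, Section 3 (HAL p. 5, (2)–(3))] -/
def InInertiaGroup (σ : L ≃ₐ[K] L) : Prop :=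
  ∃ h : σ ∈ W.decompositionSubgroup K,
    (⟨σ, h⟩ : W.decompositionSubgroup K) ∈ W.inertiaSubgroup K

/-- `σ ∈ G_r(W/V)`, the **ramification group** (Cossart–Piltant 2008, HAL p. 6: "`G_r(W/V) :=
{g ∈ G_i(W/V) | ∀ x, W(g.x − x) > W x}`", for `x ≠ 0`; a `p`-group, Zariski–Samuel [47]
Thm 24 p. 77; Mathlib has no ramification subgroup of a valuation subring yet).
[cite: CossartPiltant2008, Section 3 (HAL p. 6, definition of `G_r`)] -/
def InRamificationGroup (σ : L ≃ₐ[K] L) : Prop :=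
  InInertiaGroup K W σ ∧ ∀ x : L, x ≠ 0 → W.valuation (σ x - x) < W.valuation x

/-- "`K'` is contained in `K^i`, the **inertia field** of `W` over `V`" (Cossart–Piltant 2008,
Cor 6.3, Prop 9.3; HAL p. 5 "`K^i := L^{G_i}`"): every element of `G_i(W/V)` fixes `K'`
pointwise (the definition of the fixed field).
[cite: CossartPiltant2008, Section 3 (HAL p. 5, "inertia field")] -/
def LeInertiaField (K' : IntermediateField K L) : Prop :=
  ∀ σ : L ≃ₐ[K] L, InInertiaGroup K W σ → ∀ x : L, x ∈ K' → σ x = x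

/-- "`K'` is contained in `K^r`, the **ramification field** of `W` over `V`" (Cossart–Piltant
2008, Prop 9.5; HAL p. 6): every element of `G_r(W/V)` fixes `K'` pointwise.
[cite: CossartPiltant2008, Section 3 (HAL p. 6, "ramification field")] -/
def LeRamificationField (K' : IntermediateField K L) : Prop :=
  ∀ σ : L ≃ₐ[K] L, InRamificationGroup K W σ → ∀ x : L, x ∈ K' → σ x = x

/-- `G_r ⊆ G_i`: by definition. [folklore] -/
theorem InRamificationGroup.inInertiaGroup {σ : L ≃ₐ[K] L} (h : InRamificationGroup K W σ) :
    InInertiaGroup K W σ :=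
  h.1

/-- `K' ⊆ K^i ⇒ K' ⊆ K^r` (since `G_r ⊆ G_i`). [folklore] -/
theorem LeInertiaField.leRamificationField {K' : IntermediateField K L}
    (h : LeInertiaField K W K') : LeRamificationField K W K' :=
  fun σ hσ x hx => h σ hσ.1 x hx

end Galois

/-! ### The bridge to `Resolution.IsLocallyUniformizable` -/

section Bridge

variable {K : Type u} [Field K] (O : ValuationSubring K) (A : Subring K) (hAO : A ≤ O.toSubring)

/-- An element of the affine model `A ⊆ O` lies outside the centre `𝔪_O ∩ A` iff it is a unit of
`O`, i.e. has value `1`. [folklore] -/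
theorem mem_primeCompl_centre_iff (s : A) :
    s ∈ (Ideal.comap (Subring.inclusion hAO) (IsLocalRing.maximalIdeal O)).primeCompl ↔
      O.valuation (s : K) = 1 := by
  change s ∉ Ideal.comap (Subring.inclusion hAO) (IsLocalRing.maximalIdeal O) ↔ _
  rw [Ideal.mem_comap]
  have h1 : (Subring.inclusion hAO s ∈ IsLocalRing.maximalIdeal O) ↔ O.valuation (s : K) < 1 :=
    O.valuation_lt_one_iff ⟨(s : K), hAO s.2⟩
  rw [h1, not_lt]
  exact ⟨fun h => le_antisymm (O.valuation_le_one ⟨(s : K), hAO s.2⟩) h, fun h => h.ge⟩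

/-- **The local ring at the centre, inside `K`.** For an affine model `A ⊆ O` with `Frac A = K`,
Mathlib's localisation of `A` at the centre `𝔪_O ∩ A`, realised inside `K`
(`Localization.subalgebra.ofField`), is the set of fractions `a/s`, `a, s ∈ A`, `O(s) = 0`.
[folklore] -/
theorem coe_ofField_centre [IsFractionRing A K] :
    ((Localization.subalgebra.ofField K
        (Ideal.comap (Subring.inclusion hAO) (IsLocalRing.maximalIdeal O)).primeCompl
        (Ideal.primeCompl_le_nonZeroDivisors _) : Subalgebra A K) : Set K) =
      {x | ∃ a ∈ A, ∃ s ∈ A, O.valuation s = 1 ∧ x = a * s⁻¹} := by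
  ext x
  change (∃ (a s : A) (_ : s ∈ _), x = algebraMap A K a * (algebraMap A K s)⁻¹) ↔ _
  constructor
  · rintro ⟨a, s, hs, rfl⟩
    exact ⟨a, a.2, s, s.2, (mem_primeCompl_centre_iff O A hAO s).1 hs, rfl⟩
  · rintro ⟨a, ha, s, hs, hvs, rfl⟩
    exact ⟨⟨a, ha⟩, ⟨s, hs⟩, (mem_primeCompl_centre_iff O A hAO ⟨s, hs⟩).2 hvs, rfl⟩

/-- **`A_𝔭 ≅` the ring of fractions `{a/s}` inside `K`.** For any subring `R ⊆ K` whose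
underlying set is `{a/s : a, s ∈ A, O(s) = 0}`, Mathlib's `Localization.AtPrime` of `A` at the
centre of `O` is isomorphic to `R`. [folklore] -/
theorem nonempty_ringEquiv_localization_centre [IsFractionRing A K] (R : Subring K)
    (hR : (R : Set K) = {x | ∃ a ∈ A, ∃ s ∈ A, O.valuation s = 1 ∧ x = a * s⁻¹}) :
    Nonempty (Localization.AtPrime
      (Ideal.comap (Subring.inclusion hAO) (IsLocalRing.maximalIdeal O)) ≃+* R) := by
  classical
  have hcoe := coe_ofField_centre O A hAO
  set P := Ideal.comap (Subring.inclusion hAO) (IsLocalRing.maximalIdeal O) with hP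
  set R₁ : Subalgebra A K :=
    Localization.subalgebra.ofField K P.primeCompl (Ideal.primeCompl_le_nonZeroDivisors _)
    with hR₁
  have hx : ∀ x : K, x ∈ R₁ ↔ x ∈ R := fun x => by
    have h1 : x ∈ (R₁ : Set K) ↔ x ∈ (R : Set K) := by rw [hcoe, hR]
    simpa only [SetLike.mem_coe] using h1
  let e₁ : Localization.AtPrime P ≃ₐ[A] R₁ :=
    IsLocalization.algEquiv P.primeCompl (Localization.AtPrime P) R₁
  let e₂ : R₁ ≃+* R :=
    { toFun := fun x => ⟨x, (hx x).1 x.2⟩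
      invFun := fun y => ⟨y, (hx y).2 y.2⟩
      left_inv := fun _ => rfl
      right_inv := fun _ => rfl
      map_mul' := fun _ _ => rfl
      map_add' := fun _ _ => rfl }
  exact ⟨e₁.toRingEquiv.trans e₂⟩

end Bridge

section BridgeModels

variable {k K : Type u} [Field k] [Field K] [Algebra k K] (O : ValuationSubring K)

/-- A `k`-subalgebra and its underlying subring are the same ring. [folklore] -/
def subalgebraRingEquivToSubring (R : Subalgebra k K) : R ≃+* R.toSubring :=
  { toFun := fun x => ⟨x, x.2⟩
    invFun := fun y => ⟨y, y.2⟩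
    left_inv := fun _ => rfl
    right_inv := fun _ => rfl
    map_mul' := fun _ _ => rfl
    map_add' := fun _ _ => rfl }

/-- `Frac A = K` for the underlying subring of an affine model with `Frac A = K`. [folklore] -/
theorem isFractionRing_toSubring (A : Subalgebra k K) [IsFractionRing A K] :
    IsFractionRing A.toSubring K :=
  IsFractionRing.of_field A.toSubring K fun z => by
    obtain ⟨a, b, -, rfl⟩ := IsFractionRing.div_surjective (A := A) z
    exact ⟨⟨a, a.2⟩, ⟨b, b.2⟩, rfl⟩

/-- **A local uniformization in Cossart–Piltant's sense uniformizes in the tree's sense**: if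
`R ⊆ K` is a regular local model of `O` on the affine model `A`, then `A` is regular at the
centre of `O` (`Resolution.IsLocallyUniformizable`). [folklore] -/
theorem IsLocalUniformizationOf.isLocallyUniformizable {R : Subalgebra k K}
    (h : IsLocalUniformizationOf k K O R) : IsLocallyUniformizable k K O := by
  obtain ⟨⟨A, hfg, hfrac, hAO, hR⟩, hreg⟩ := h
  haveI : IsFractionRing A.toSubring K := isFractionRing_toSubring A
  obtain ⟨e⟩ := nonempty_ringEquiv_localization_centre O A.toSubring hAO R.toSubring hR
  haveI : IsRegularLocalRing R.toSubring :=
    @IsRegularLocalRing.of_ringEquiv R _ hreg _ _ (subalgebraRingEquivToSubring R)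
  exact ⟨A, hAO, hfg, hfrac, IsRegularLocalRing.of_ringEquiv e.symm⟩

/-- **Conversely**, an affine model `A ⊆ O` regular at the centre of `O` yields the local
uniformization `R = A_𝔭 ⊆ K` of `O` in Cossart–Piltant's sense. [folklore] -/
theorem exists_isLocalUniformizationOf (h : IsLocallyUniformizable k K O) :
    ∃ R : Subalgebra k K, IsLocalUniformizationOf k K O R := by
  classical
  obtain ⟨A, hAO, hfg, hfrac, hreg⟩ := h
  haveI : IsFractionRing A.toSubring K := isFractionRing_toSubring A
  set P := Ideal.comap (Subring.inclusion hAO) (IsLocalRing.maximalIdeal O) with hP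
  let R₁ : Subalgebra A.toSubring K :=
    Localization.subalgebra.ofField K P.primeCompl (Ideal.primeCompl_le_nonZeroDivisors _)
  have hR₁ : (R₁ : Set K) = {x | ∃ a ∈ A, ∃ s ∈ A, O.valuation s = 1 ∧ x = a * s⁻¹} :=
    coe_ofField_centre O A.toSubring hAO
  have hAR : ∀ a : K, a ∈ A → a ∈ R₁ := fun a ha => by
    rw [← SetLike.mem_coe, hR₁]
    exact ⟨a, ha, 1, A.one_mem, by simp, by simp⟩
  let R : Subalgebra k K :=
    { carrier := R₁
      mul_mem' := fun ha hb => R₁.mul_mem ha hb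
      one_mem' := R₁.one_mem
      add_mem' := fun ha hb => R₁.add_mem ha hb
      zero_mem' := R₁.zero_mem
      algebraMap_mem' := fun c => hAR _ (A.algebraMap_mem c) }
  have hR : (R : Set K) = {x | ∃ a ∈ A, ∃ s ∈ A, O.valuation s = 1 ∧ x = a * s⁻¹} := hR₁
  obtain ⟨e⟩ := nonempty_ringEquiv_localization_centre O A.toSubring hAO R.toSubring hR
  haveI : IsRegularLocalRing (Localization.AtPrime P) := hreg
  haveI : IsRegularLocalRing R.toSubring := IsRegularLocalRing.of_ringEquiv e
  exact ⟨R, ⟨A, hfg, hfrac, hAO, hR⟩,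
    IsRegularLocalRing.of_ringEquiv (subalgebraRingEquivToSubring R).symm⟩

/-- **Bridge.** `O` is locally uniformizable over `k` in the sense of the tree
(`Resolution.IsLocallyUniformizable`: some affine model `A ⊆ O` of `K` is regular at the centre
of `O`) iff `O` has a local uniformization `R ⊆ K` in the sense of Cossart–Piltant 2008 §3.
[folklore] -/
theorem isLocallyUniformizable_iff_exists_isLocalUniformizationOf :
    IsLocallyUniformizable k K O ↔ ∃ R : Subalgebra k K, IsLocalUniformizationOf k K O R :=
  ⟨exists_isLocalUniformizationOf O, fun ⟨_, h⟩ => h.isLocallyUniformizable O⟩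

/-- A local uniformization is in particular a local model. [folklore] -/
theorem IsLocalUniformizationOf.isLocalModelOf {R : Subalgebra k K}
    (h : IsLocalUniformizationOf k K O R) : IsLocalModelOf k K O R :=
  h.1

/-- A normal local model is in particular a local model. [folklore] -/
theorem IsNormalLocalModelOf.isLocalModelOf {R : Subalgebra k K}
    (h : IsNormalLocalModelOf k K O R) : IsLocalModelOf k K O R :=
  h.1

end BridgeModels

end Literature.AlgebraicGeometry.CossartPiltant200819.CP2008

end
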